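import Summits.QuantumFields.YangMills.Theses.SqueezedSkewness
import Summits.QuantumFields.YangMills.Theorems.BalabanLadderNTMarkovMirrorReflect

/-!
# Birth skeleton — LINE «Markov ceiling» (planner ym-idea-6 g11): split of
`SqueezedSkewness.AntipodalMirrorCeiling` (stmt-QuantumFields-23202) into `FloorUnitFBL6` + `AntipodalMixing`
+ the generated glue item `AntipodalMarkovGlue : FloorUnitFBL6 → AntipodalMixing → AntipodalMirrorCeiling`.

Mechanism (glue, M/L−): the tree's Markov-mirror identity X2
(`Cruxes.NT.MarkovMirror.torusCov_reflect_lift_eq_torusCov_reflect_kerE`) makes the antipodal mirror number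
N_T(⌊T/4⌋) the reflection covariance of the Dirichlet boundary response Φ of ONE femto cube around
z₀ = (⌊T/4⌋, 0⃗); the femto boundary law FBL6 bounds sup |Φ − Σp| ≤ 6C₁/d⁴ ≍ a⁴ (UV, canonical);
sup-normalised antipodal mixing supplies the η (IR, rate-free).  Stubs = the split's items BY NAME, plus (v2, per
idea-crit-9 VERDICT #53 P2) the NARROW TWIN `stub_boundaryResponseMixing` — mixing asked only for the one family the
glue consumes (the sup-normalised Dirichlet boundary response of a femto cube straddling the slice h = (2L+1)/4, in
`torusE`/`kerE`/`cfgReflect` vocabulary) — with its own glue `stub_markovGlueNarrow` and the comparison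
`stub_twinOfMixing : AntipodalMixing → twin` (dictionary + spatial translation invariance, S/M).
No summit / NT statement is proved here; the YM mass gap is not proved. -/

set_option autoImplicit false

namespace Summit.QuantumFields.YangMills.Cruxes.NT.AntipodalMarkovBirth

open Summit.QuantumFields.YangMills.Theses.SqueezedSkewness
open Literature.MathematicalPhysics.QuantumFieldTheory Literature.MathematicalPhysics.QuantumLattice
open Summit.QuantumFields.YangMills.Cruxes.OSLegsFromFemtoAndGap.DlrCollarTransfer

namespace __Registered

/-- = `SqueezedSkewness.FloorUnitFBL6` (crux, XL; shared with the ElectricSeamH split). -/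
abbrev stub_floorUnitFBL6 : Prop :=
  Summit.QuantumFields.YangMills.Theses.SqueezedSkewness.FloorUnitFBL6

/-- = `SqueezedSkewness.AntipodalMixing` (crux, L+/XL; the genuinely new open item). -/
abbrev stub_antipodalMixing : Prop :=
  Summit.QuantumFields.YangMills.Theses.SqueezedSkewness.AntipodalMixing

/-- = the generated glue item `SqueezedSkewness.AntipodalMarkovGlue` (support, M/L−: dictionary + X2 + FBL6 sup
bound + AntipodalMixing with η′ = η ℓ₁⁸/(36 C₁² 8⁸)). -/
abbrev stub_markovGlue : Prop :=
  Summit.QuantumFields.YangMills.Theses.SqueezedSkewness.AntipodalMarkovGlue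

/-- **Narrow twin (v2, idea-crit-9 #53 P2)** `BoundaryResponseMixing`: sup-normalised antipodal mixing asked ONLY for
the Dirichlet boundary responses `Ψ_z(V) = kerE_Q^V(dens z)` of femto cubes `Q = (c, b)` (`b·a(β) ≤ ℓ`) inside the X2
window and straddling the slice `h = (2L+1)/4`: for every centring `m` and every sup bound `s` of `Ψ_z − m`,
`Cov_T(Ψ_z∘Θ₀, Ψ_z) ≤ τ·s²` once `β ≥ β₆`, `a(β)·L ≥ Λ₆`.  This is what `AntipodalMarkovGlue` consumes (with
`m = Σ_q p_q`, `s = 6C₁/d⁴` from FBL6); conceivable route: exterior-insensitivity à la FBL6 + clustering of smeared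
curvature.  Size XL / open. -/
abbrev stub_boundaryResponseMixing : Prop :=
  ∀ (G : Type) [Group G] [TopologicalSpace G] [IsTopologicalGroup G] [CompactSpace G], IsCompactSimpleLieGroup G → letI : MeasurableSpace G := borel G; haveI : BorelSpace G := ⟨rfl⟩; ∀ (r : LatticeRep G) (a : ℝ → ℝ), (∀ β, 0 < a β) → Filter.Tendsto a Filter.atTop (nhds 0) → ∀ (ℓ τ : ℝ), 0 < ℓ → 0 < τ → ∃ (β₆ Λ₆ : ℝ), ∀ β : ℝ, β₆ ≤ β → ∀ L : ℕ, Λ₆ ≤ a β * L → ∀ (c : Fin 4 → ℤ) (b : ℕ), (b : ℝ) * a β ≤ ℓ → 1 ≤ c 0 → c 0 + (b : ℤ) + 3 ≤ (L : ℤ) → (∀ j : Fin 4, -(L : ℤ) + 2 ≤ c j ∧ c j + (b : ℤ) + 2 ≤ (L : ℤ) + 1) → c 0 ≤ (((2 * L + 1) / 4 : ℕ) : ℤ) → (((2 * L + 1) / 4 : ℕ) : ℤ) ≤ c 0 + (b : ℤ) → ∀ (z : Fin 4 → ℤ), 1 ≤ depth c b z → ∀ (m s : ℝ), (∀ V : LGConfig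 4 G, |kerE G r β c b V (dens G r z) - m| ≤ s) → torusE G r β L (fun V => kerE G r β c b (cfgReflect V) (dens G r z) * kerE G r β c b V (dens G r z)) - torusE G r β L (fun V => kerE G r β c b (cfgReflect V) (dens G r z)) * torusE G r β L (fun V => kerE G r β c b V (dens G r z)) ≤ τ * s ^ 2

/-- Glue for the narrow twin (support, M/L−; = `AntipodalMarkovGlue` minus the measurability/locality transport):
`FloorUnitFBL6 → BoundaryResponseMixing → AntipodalMirrorCeiling`. -/
abbrev stub_markovGlueNarrow : Prop :=
  Summit.QuantumFields.YangMills.Theses.SqueezedSkewness.FloorUnitFBL6 → stub_boundaryResponseMixing →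
    Summit.QuantumFields.YangMills.Theses.SqueezedSkewness.AntipodalMirrorCeiling

/-- Comparison (support, S/M): the filed item implies the twin — Fin-torus ↔ `torusE` dictionary
(ThermalDescentTorusDictionary, `refl` ↔ `cfgReflect`), locality of `kerE_Q(dens z)` in the closed cube
(`kerE_supp_window`), spatial translation invariance of the torus state (the straddling cube sits within sup-distance
`b + 1` of a spatial translate of `x₀ = (0⃗, h)`), continuity ⇒ measurability (`Reference.continuous_kerE`),
`F := (Ψ_z − m)/s`. -/
abbrev stub_twinOfMixing : Prop :=
  Summit.QuantumFields.YangMills.Theses.SqueezedSkewness.AntipodalMixing → stub_boundaryResponseMixing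

end __Registered

/-- stub (crux, XL): the femto boundary law at floor-calibrated units. OPEN. -/
theorem stub_floorUnitFBL6 : __Registered.stub_floorUnitFBL6 := by
  sorry

/-- stub (crux, L+/XL): sup-normalised antipodal mixing on the hypercube. OPEN. -/
theorem stub_antipodalMixing : __Registered.stub_antipodalMixing := by
  sorry

/-- stub (support, M/L−): the Markov-ceiling glue. OPEN (tree-plumbed: X2 + ThermalDescentTorusDictionary). -/
theorem stub_markovGlue : __Registered.stub_markovGlue := by
  sorry

/-- stub (crux-twin, XL/open): boundary-response mixing. OPEN. -/
theorem stub_boundaryResponseMixing : __Registered.stub_boundaryResponseMixing := by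
  sorry

/-- stub (support, M/L−): glue for the twin. OPEN. -/
theorem stub_markovGlueNarrow : __Registered.stub_markovGlueNarrow := by
  sorry

/-- stub (support, S/M): the filed mixing item implies the twin. OPEN. -/
theorem stub_twinOfMixing : __Registered.stub_twinOfMixing := by
  sorry

/-- **AntipodalMirrorCeiling_of_narrow** — the crux BY NAME from the UV item and the NARROW twin (v2 route for provers:
prove `stub_boundaryResponseMixing` rather than the full `AntipodalMixing`). -/
theorem AntipodalMirrorCeiling_of_narrow (h1 : __Registered.stub_floorUnitFBL6)
    (hN : __Registered.stub_boundaryResponseMixing) (hG : __Registered.stub_markovGlueNarrow) :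
    AntipodalMirrorCeiling :=
  hG h1 hN

/-- Consistency: the filed decomposition factors through the twin. -/
theorem AntipodalMirrorCeiling_of_via_twin (h1 : __Registered.stub_floorUnitFBL6)
    (h2 : __Registered.stub_antipodalMixing) (hT : __Registered.stub_twinOfMixing)
    (hG : __Registered.stub_markovGlueNarrow) : AntipodalMirrorCeiling :=
  hG h1 (hT h2)

/-- **AntipodalMirrorCeiling_of** — the crux BY NAME from the three stubs (kernel-checked composition). -/
theorem AntipodalMirrorCeiling_of (h1 : __Registered.stub_floorUnitFBL6) (h2 : __Registered.stub_antipodalMixing)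
    (h3 : __Registered.stub_markovGlue) : AntipodalMirrorCeiling := by
  have h : FloorUnitFBL6 → AntipodalMixing → AntipodalMirrorCeiling := h3
  exact h h1 h2

theorem antipodalMirrorCeiling_holds_of_stubs : AntipodalMirrorCeiling :=
  AntipodalMirrorCeiling_of stub_floorUnitFBL6 stub_antipodalMixing stub_markovGlue

end Summit.QuantumFields.YangMills.Cruxes.NT.AntipodalMarkovBirth
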